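import Summits.BirchSwinnertonDyer.BirchSwinnertonDyer.Theorems.AlignedTransportAtTwoMainConjectureOfRankZeroBSDAtTwoTwistReading
import Summits.BirchSwinnertonDyer.BirchSwinnertonDyer.Theorems.AlignedTransportAtTwoMainConjectureOfRankZeroBSDAtTwoCyclotomicLayerWeightEuler
import Summits.BirchSwinnertonDyer.BirchSwinnertonDyer.Theorems.TwoAdicConverseEulerCharKernelAtTwoHolds
import Literature.NumberTheory.EllipticCurves.IwasawaSelmerControlOfLayerKernelsProofs
import Literature.NumberTheory.EllipticCurves.SelmerCorankControlRatProofs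
import Literature.NumberTheory.EllipticCurves.PAdicBSDKatoFiniteProofs
import Literature.NumberTheory.EllipticCurves.MordellWeilRankZeroProofs
import HarnessLib

/-!
# Route `AlignedTransportAtTwo`, crux C2 `MainConjectureOfRankZeroBSDAtTwo` (stmt-BirchSwinnertonDyer-22298):
# THE TWIST-SATURATION DOOR — `rank W⁽²⁾(ℚ) + μ(X(W/ℚ_∞)) ≤ e(W)`, the EULER WEIGHT
# `e(W) = ord₂ ∏c_ℓ + 2·ord₂ #Ẽ(𝔽₂)[2^∞] + ord₂ #Sel_{2^∞}(W/ℚ) − 2·ord₂ #W(ℚ)[2^∞]`, UNCONDITIONALLY; hence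
# `rank W⁽²⁾(ℚ) ≥ e(W) ⟹ μ = 0`, `λ = e(W)`, `char_Λ X(W/ℚ_∞) = ((T+2)^{e(W)})`, and (mod PRINT) Mazur's main conjecture at `2` for `W`

HONEST FRAMING (cell `bsd-f1-sign2`, WIDTH-5 attached prover seat `bsd-line-att-p5` gen 46 on line `birth` of the lead `bsd-line-att-p2`;
`--supports` stmt-BirchSwinnertonDyer-22298, closes nothing; BSD is NOT proved by any of this; the crux C2, its verdict «blocked-on
`Rank1Residual.GreenbergMuConjectureIrreducible`» and every registered stub (P / T / Kμ / LimDoor / MuIneqʳ / PFμ⁺) are untouched). THEOREMS ONLY —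
no `def`, no instance, no named fact, no `sorry`.

THE POINT. The lineage's layer-rank doors (`…LambdaSeed.mazurMainConjecture_two_of_bsdp_of_layerRankGEAt`, `…EisensteinRigidityLambdaTwo`,
`…TwistReadingBounds.hasOrderAtNegTwo_charGen_of_le_mordellWeilRank_twist`, bsd-2adic's `TwoAdicConverseLambdaHalfTwistRankDoor`) compare the
Mordell–Weil rank of the quadratic twist `W⁽²⁾` (by `ℚ(√2) = ℚ_1`, the first layer of the cyclotomic `ℤ₂`-tower) with an ANALYTIC certificate
(`λ(L₂) = n`, `ord_{T=−2} L₂ = n`, the road's unit symbol). This file compares it with the EULER WEIGHT of Greenberg's Theorem 4.1, which is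
arithmetic of `W` over `ℚ` and a kernel theorem of the tree (`TwoAdicEulerCharKernel.thm41_charValue_rankZero_anyPrime_holds`, cell bsd-2adic):
with `f_X` a generator of `char_Λ X(W/ℚ_∞)`, `‖f_X(0)‖₂ = 2^{−e(W)}` (g37 `…CyclotomicLayerWeightEuler.norm_constantCoeff_charGen_eq_of_thm41`), while
`(T+2)^{rank W⁽²⁾(ℚ)} ∣ f_X` (g38 `…TwistReading.X_add_C_two_pow_mordellWeilRank_twist_dvd_charGen`) and every factor `T+2` weighs one power of `2` at
`T = 0` on top of `2^{μ}` (g38 `norm_constantCoeff_le_two_inv_pow_mu_add_of_dvd`). Hence, with NO named fact and NO `L`-function: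

* §1 (algebra in `ℤ₂⟦T⟧`) `mu_add_le_of_X_add_C_two_pow_dvd` (**`(T+2)^k ∣ F`, `‖F(0)‖₂ = 2^{−w} ⟹ μ(F) + k ≤ w`**), and at saturation `k = w`:
  `associated_X_add_C_two_pow_of_dvd` (**`F ~ (T+2)^w`**), `mu_eq_zero_and_lam_eq_of_X_add_C_two_pow_dvd` (`μ(F) = 0`, `λ(F) = w`).
* §2 (datum level; `W/ℚ` globally minimal, good ordinary at `2`, `Sel_{2^∞}(W/ℚ)` finite, `W₂` ANY `ℚ`-model of `W⁽²⁾`, `(κ, γ)` the normalised cyclotomic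
  datum, `D` any dual datum; `#W(ℚ)[2^∞] = 2^t`, `#Ẽ(𝔽₂)[2^∞] = 2^e`, `#Sel_{2^∞}(W/ℚ) = 2^s`, `v = ord₂ ∏c_ℓ`) ★★ `mordellWeilRank_twist_add_mu_add_le`:
  **`rank W₂(ℚ) + μ(X) + 2t ≤ v + 2e + s`**, and `selmerCorank_twist_add_mu_add_le` (the `ℤ₂`-corank of `Sel_{2^∞}(W⁽²⁾/ℚ)` in place of the rank);
  ★★★ `mu_eq_zero_of_le_mordellWeilRank_twist`: **`v + 2e + s ≤ rank W₂(ℚ) + 2t ⟹ μ(X) = 0 ∧ λ(X) = rank W₂(ℚ) ∧ char_Λ X = ((T+2)^{rank W₂(ℚ)})`** — at a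
  twist-saturated curve the whole Iwasawa module of `W` over `ℚ_∞` is carried by the rational points of the twist.
* §3 (datum-free) ★★ `mordellWeilRank_twist_le`: **`rank W⁽²⁾(ℚ) + 2t ≤ v + 2e + s`** — a Mordell–Weil bound for the `√2`-twist from the arithmetic of `W` over `ℚ`
  ALONE (`≤ 2` for a clean `a₂ = +1`, `Ш[2] = 0`, `E(ℚ)[2] = 0` curve; the lineage's `…TwistReadingBounds` had it modulo Kato 17.4 at the unit central symbol);
  ★★★ `forall_mu_eq_zero_of_le_mordellWeilRank_twist`: saturation ⟹ `μ(X(W/ℚ_∞)) = 0` at EVERY normalised cyclotomic dual datum — a certificate for stub T at the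
  curve `W` made of RATIONAL POINTS ON `W⁽²⁾` and the numbers `t, e, s, v` (no layer descent, no modular symbol, no `2`-adic `L`-function).
* §4 (mod PRINT, C2's own binders) ★★★ `mazurMainConjecture_two_of_bsdp_of_le_mordellWeilRank_twist`: on the seed cell (good ordinary at `2`, no rational point of
  order `2`, `r_an = 0`, `BSD(W,2)`; PRINT `h17`, `hper`, `hmod`, `hGZK` — `hGr` is now the tree theorem) **`v + 2e + s ≤ rank W₂(ℚ) ⟹ MazurMainConjecture W 2`**
  (the Seed door `mazurMainConjecture_two_of_bsdp_of_mu_eq_zero` fed by §3; C2's analytic-`μ` binder is idle here); and the unit-symbol forms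
  ★★ `mazurMainConjecture_two_of_bsdp_of_two_le_mordellWeilRank_twist` (`a₂ = +1`, `‖[0]⁺_f‖₂ = 1`: **two independent rational points on `W⁽²⁾` ⟹ MC₂(W)**) and
  `…_of_four_le_…` (`a₂ = −1`: four points).

HONEST SCOPE. The door fires exactly on TWIST-SATURATED seeds (`rank W⁽²⁾(ℚ) = e(W)`; `w(W⁽²⁾) = +1` needs `N_W ≡ ±1 (mod 8)`, then `rank W⁽²⁾ ∈ {0, 2}` on
the clean `a₂ = +1` sub-cell); it is EMPTY on the lineage's `Δ_min ≡ 3, 5 (mod 8)` road (`corank Sel_{2^∞}(W⁽²⁾/ℚ) = 1 < 2 ≤ e` there). No particular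
curve is certified in this file. BSD is not proved by any of this. References: R. Greenberg, LNM 1716 (1999), Thm. 1.4, 1.9, §3 L.3.1, Thm. 4.1, §4 p. 107
[GreenbergLNM1716]; K. Kato, Astérisque 295 (2004), Thm. 17.4 [Kato2004Asterisque]; L. Washington, GTM 83, §7.1, §13.2 [Washington1997]; B. Mazur, J. Tate,
J. Teitelbaum, Invent. Math. 84 (1986) §I.14 [MazurTateTeitelbaum1986Invent]; A. Abbes, E. Ullmo, Compositio 103 (1996), Thm. A [AbbesUllmo1996].
-/

set_option linter.dupNamespace false
set_option autoImplicit false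

noncomputable section

open scoped Classical MatrixGroups ModularForm

namespace Summit.BirchSwinnertonDyer.BirchSwinnertonDyer.Theorems.AlignedTransportAtTwoTwistSaturation

open PowerSeries CongruenceSubgroup WeierstrassCurve Literature.NumberTheory.EllipticCurves
  Literature.NumberTheory.EllipticCurves.ModularForms
  Literature.NumberTheory.EllipticCurves.Rank1Residual
  Literature.NumberTheory.EllipticCurves.Rank1Residual.Typed
  Literature.NumberTheory.EllipticCurves.Greenberg1999
  Literature.NumberTheory.EllipticCurves.Module
  Literature.NumberTheory.EllipticCurves.IwasawaAlgebra
  Literature.NumberTheory.EllipticCurves.PadicIntSeries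
  Summit.BirchSwinnertonDyer.Rank1Residual
  Summit.BirchSwinnertonDyer.Rank1Residual.X1.MuLambda
  Summit.BirchSwinnertonDyer.Rank1Residual.X1.MuPart
  Summit.BirchSwinnertonDyer.Rank1Residual.X1.ParitySqueeze
  Summit.BirchSwinnertonDyer.Rank1Residual.X1.CyclotomicZeros
  Summit.BirchSwinnertonDyer.Rank1Residual.X5
  Summit.BirchSwinnertonDyer.Rank1Residual.F1Sign2
  Summit.BirchSwinnertonDyer.Rank1Residual.Iwasawa
  Summit.BirchSwinnertonDyer.BirchSwinnertonDyer.Theorems.Rank1ResidualX1Defs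
  Summit.BirchSwinnertonDyer.BirchSwinnertonDyer.Theorems.AlignedTransportAtTwoSeed
  Summit.BirchSwinnertonDyer.BirchSwinnertonDyer.Theorems.AlignedTransportAtTwoEisensteinRigidity
  Summit.BirchSwinnertonDyer.BirchSwinnertonDyer.Theorems.AlignedTransportAtTwoEisensteinRigidityRoad
  Summit.BirchSwinnertonDyer.BirchSwinnertonDyer.Theorems.AlignedTransportAtTwoEisensteinRigidityConservation
  Summit.BirchSwinnertonDyer.BirchSwinnertonDyer.Theorems.AlignedTransportAtTwoTwistReading
  Summit.BirchSwinnertonDyer.BirchSwinnertonDyer.Theorems.AlignedTransportAtTwoCyclotomicLayerWeightEuler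
  Summit.BirchSwinnertonDyer.BirchSwinnertonDyer.Theorems.TwoAdicEulerCharKernel

/-! ## §1 Algebra in `ℤ₂⟦T⟧`: a `(T+2)`-power divisor against a known weight -/

section Algebra

/-- **`(T+2)^k ∣ F` and `‖F(0)‖₂ = 2^{−w}` force `μ(F) + k ≤ w`** (g38: `‖F(0)‖₂ ≤ 2^{−(μ(F)+k)}`). [cite: Washington1997, §7.1] -/
theorem mu_add_le_of_X_add_C_two_pow_dvd {F : PowerSeries ℤ_[2]} {k w : ℕ}
    (hk : (X + C (2 : ℤ_[2])) ^ k ∣ F) (hw : ‖constantCoeff F‖ = (2 : ℝ)⁻¹ ^ w) : mu F + k ≤ w := by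
  have h := norm_constantCoeff_le_two_inv_pow_mu_add_of_dvd hk
  rw [hw] at h
  exact (pow_le_pow_iff_right_of_lt_one₀ (by norm_num) (by norm_num)).mp h

/-- **Saturation**: `(T+2)^w ∣ F` and `‖F(0)‖₂ = 2^{−w}` force `F ~ (T+2)^w` (the cofactor has unit constant term, hence is a unit of `ℤ₂⟦T⟧`).
[cite: Washington1997, §7.1] -/
theorem associated_X_add_C_two_pow_of_dvd {F : PowerSeries ℤ_[2]} {w : ℕ}
    (hk : (X + C (2 : ℤ_[2])) ^ w ∣ F) (hw : ‖constantCoeff F‖ = (2 : ℝ)⁻¹ ^ w) :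
    Associated ((X + C (2 : ℤ_[2])) ^ w) F := by
  obtain ⟨g, rfl⟩ := hk
  have hpos : ((2 : ℝ)⁻¹ ^ w) ≠ 0 := pow_ne_zero _ (by norm_num)
  have hg1 : ‖constantCoeff g‖ = 1 := by
    rw [map_mul, norm_mul, norm_constantCoeff_X_add_C_two_pow] at hw
    exact mul_left_cancel₀ hpos (by rw [mul_one]; exact hw)
  have hgu : IsUnit g := by
    rw [PowerSeries.isUnit_iff_constantCoeff]
    exact PadicInt.isUnit_iff.mpr hg1
  exact associated_mul_unit_right _ _ hgu

/-- **Saturation, invariants**: `(T+2)^w ∣ F` and `‖F(0)‖₂ = 2^{−w}` force `μ(F) = 0` and `λ(F) = w`. [cite: Washington1997, §7.1] -/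
theorem mu_eq_zero_and_lam_eq_of_X_add_C_two_pow_dvd {F : PowerSeries ℤ_[2]} {w : ℕ}
    (hk : (X + C (2 : ℤ_[2])) ^ w ∣ F) (hw : ‖constantCoeff F‖ = (2 : ℝ)⁻¹ ^ w) : mu F = 0 ∧ lam F = w := by
  have hμ : mu F = 0 := by have := mu_add_le_of_X_add_C_two_pow_dvd hk hw; omega
  refine ⟨hμ, ?_⟩
  obtain ⟨u, hu⟩ := associated_X_add_C_two_pow_of_dvd hk hw
  have hX : (X + C (2 : ℤ_[2]) : PowerSeries ℤ_[2]) ^ w ≠ 0 := pow_ne_zero _ prime_X_add_C_two.ne_zero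
  have hune : ((u : PowerSeries ℤ_[2])) ≠ 0 := u.ne_zero
  obtain ⟨-, -, hlamu⟩ := (isUnit_iff_mu_eq_zero_and_lam_eq_zero (u : PowerSeries ℤ_[2])).mp u.isUnit
  rw [← hu, lam_mul hX hune, lam_X_add_C_two_pow, hlamu, add_zero]

end Algebra

/-! ## §2 Datum level: `rank W⁽²⁾(ℚ) + μ(X(W/ℚ_∞)) + 2t ≤ v + 2e + s`, and the saturated case -/

section Datum

variable (κ : ZpExtension ℚ 2) (hκ : κ.IsCyclotomic) {γ : Field.absoluteGaloisGroup ℚ} (hγ : κ.IsTopGenerator γ)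
  (hγ' : IsCyclotomicVariable 2 γ)
  (W W₂ : WeierstrassCurve ℚ) [W.IsElliptic] [W.IsGloballyMinimal] [W₂.IsElliptic] {V : VariableChange ℚ}
  (hV : V • W₂ = W.quadraticTwist 2)

include hκ hγ in
omit [W₂.IsElliptic] in
/-- **`X(W/ℚ_∞)` is `Λ`-torsion, KATO-FREE** — good ordinary at `2` and `Sel_{2^∞}(W/ℚ)` finite (Greenberg's Thm. 1.4, the tree theorem
`SelmerDualData.isTorsion_of_finite_selmerGroup_rat`, its place-wise hypothesis from `hasGoodReductionAt_and_hasUnitRootAt_of_rat`).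
[cite: GreenbergLNM1716, Thm. 1.4 (p. 60)] -/
theorem isTorsion_of_finite (hord : IsOrdinaryAt W 2) (D : W.SelmerDualData κ γ) (hfin : Finite (W.selmerGroupPInfty 2)) :
    D.IsTorsion :=
  D.isTorsion_of_finite_selmerGroup_rat hκ
    (W.hasGoodReductionAt_and_hasUnitRootAt_of_rat ((isOrdinaryAt_iff W 2).mp hord).1 ((isOrdinaryAt_iff W 2).mp hord).2) hγ hfin

include hκ hγ hγ' hV in
/-- ★★ **`rank W⁽²⁾(ℚ) + μ(X(W/ℚ_∞)) + 2t ≤ v + 2e + s` — UNCONDITIONAL.** `W/ℚ` globally minimal, good ordinary at `2`, `Sel_{2^∞}(W/ℚ)` finite;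
`W₂` ANY `ℚ`-model of the quadratic twist `W⁽²⁾` (`V • W₂ = W.quadraticTwist 2`); `(κ, γ)` the cyclotomic `ℤ₂`-extension with a normalised
topological generator, `D` any Pontryagin-dual datum of `Sel_{2^∞}(W/ℚ_∞)`; `#W(ℚ)[2^∞] = 2^t`, `#Ẽ(𝔽₂)[2^∞] = 2^e`, `#Sel_{2^∞}(W/ℚ) = 2^s`,
`v = ord₂ ∏c_ℓ`. Proof: `‖f_X(0)‖₂ = 2^{−(v+2e+s−2t)}` (Greenberg's Thm. 4.1, tree theorem, read by g37) and `(T+2)^{rank W₂(ℚ)} ∣ f_X` (g38) with §1;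
`μ(f_X) = μ(X)` by the structure theorem. [cite: GreenbergLNM1716, Thm. 1.9 (p. 63), Thm. 4.1 (p. 102), §4 p. 107] [cite: Washington1997, §13.2] -/
theorem mordellWeilRank_twist_add_mu_add_le (hord : IsOrdinaryAt W 2) (D : W.SelmerDualData κ γ)
    (hfin : Finite (W.selmerGroupPInfty 2)) {t e s : ℕ}
    (ht : Nat.card (AddCommGroup.primaryComponent W.toAffine.Point 2) = 2 ^ t)
    (he : Nat.card (AddCommGroup.primaryComponent ((integralModelInt W).map (Int.castRingHom (ZMod 2))).toAffine.Point 2) = 2 ^ e)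
    (hs : Nat.card (W.selmerGroupPInfty 2) = 2 ^ s) :
    W₂.mordellWeilRank + D.mu + 2 * t ≤ padicValNat 2 W.tamagawaProduct + 2 * e + s := by
  haveI : Module.Finite (IwasawaAlgebra 2) D.X := D.module_finite_holds hγ
  haveI : (charIdeal (IwasawaAlgebra 2) D.X).IsPrincipal := charIdeal_isPrincipal_holds 2 D.X
  obtain ⟨fX, hfX⟩ := Submodule.IsPrincipal.principal (charIdeal (IwasawaAlgebra 2) D.X)
  have hchar : D.charIdeal = Ideal.span {fX} := hfX
  have hD : D.IsTorsion := isTorsion_of_finite κ hκ hγ W hord D hfin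
  obtain ⟨hineq, hnorm⟩ := norm_constantCoeff_charGen_eq_of_thm41 W thm41_charValue_rankZero_anyPrime_holds
    ((isOrdinaryAt_iff W 2).mp hord).1 ((isOrdinaryAt_iff W 2).mp hord).2 hκ hγ hγ' D hD hchar hfin ht he hs
  have hdvd := X_add_C_two_pow_mordellWeilRank_twist_dvd_charGen κ hκ hγ W W₂ hV D hD hchar
  have hle := mu_add_le_of_X_add_C_two_pow_dvd hdvd hnorm
  have hfX0 : constantCoeff fX ≠ 0 := by
    intro h0
    rw [h0, norm_zero] at hnorm
    exact (pow_ne_zero _ (by norm_num : ((2 : ℝ)⁻¹) ≠ 0)) hnorm.symm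
  have hfXne : fX ≠ 0 := fun h0 => hfX0 (by rw [h0, map_zero])
  have hmufX : mu fX = D.mu := mu_generator_eq_muInvariant D.X hD hfXne hchar
  rw [← hmufX]
  omega

include hκ hγ hγ' hV in
/-- ★★ **Selmer form: `corank_{ℤ₂} Sel_{2^∞}(W⁽²⁾/ℚ) + μ(X(W/ℚ_∞)) + 2t ≤ v + 2e + s`** (same hypotheses; g38's Selmer divisibility
`(T+2)^{corank} ∣ f_X`, Greenberg's Lemma 3.1 for the twist). [cite: GreenbergLNM1716, §3 Lemma 3.1 (p. 86), Thm. 4.1 (p. 102), §4 p. 107] -/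
theorem selmerCorank_twist_add_mu_add_le (hord : IsOrdinaryAt W 2) (D : W.SelmerDualData κ γ)
    (hfin : Finite (W.selmerGroupPInfty 2)) {t e s : ℕ}
    (ht : Nat.card (AddCommGroup.primaryComponent W.toAffine.Point 2) = 2 ^ t)
    (he : Nat.card (AddCommGroup.primaryComponent ((integralModelInt W).map (Int.castRingHom (ZMod 2))).toAffine.Point 2) = 2 ^ e)
    (hs : Nat.card (W.selmerGroupPInfty 2) = 2 ^ s) :
    W₂.selmerCorank 2 + D.mu + 2 * t ≤ padicValNat 2 W.tamagawaProduct + 2 * e + s := by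
  haveI : Module.Finite (IwasawaAlgebra 2) D.X := D.module_finite_holds hγ
  haveI : (charIdeal (IwasawaAlgebra 2) D.X).IsPrincipal := charIdeal_isPrincipal_holds 2 D.X
  obtain ⟨fX, hfX⟩ := Submodule.IsPrincipal.principal (charIdeal (IwasawaAlgebra 2) D.X)
  have hchar : D.charIdeal = Ideal.span {fX} := hfX
  have hD : D.IsTorsion := isTorsion_of_finite κ hκ hγ W hord D hfin
  obtain ⟨hineq, hnorm⟩ := norm_constantCoeff_charGen_eq_of_thm41 W thm41_charValue_rankZero_anyPrime_holds
    ((isOrdinaryAt_iff W 2).mp hord).1 ((isOrdinaryAt_iff W 2).mp hord).2 hκ hγ hγ' D hD hchar hfin ht he hs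
  have hdvd := X_add_C_two_pow_selmerCorank_twist_dvd_charGen κ hκ hγ W W₂ hV D hD hchar
  have hle := mu_add_le_of_X_add_C_two_pow_dvd hdvd hnorm
  have hfX0 : constantCoeff fX ≠ 0 := by
    intro h0
    rw [h0, norm_zero] at hnorm
    exact (pow_ne_zero _ (by norm_num : ((2 : ℝ)⁻¹) ≠ 0)) hnorm.symm
  have hfXne : fX ≠ 0 := fun h0 => hfX0 (by rw [h0, map_zero])
  have hmufX : mu fX = D.mu := mu_generator_eq_muInvariant D.X hD hfXne hchar
  rw [← hmufX]
  omega

include hκ hγ hγ' hV in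
/-- ★★★ **THE TWIST-SATURATION DOOR, datum level.** Same hypotheses; if the twist's rank SATURATES the Euler weight,
`v + 2e + s ≤ rank W₂(ℚ) + 2t`, then **`μ(X(W/ℚ_∞)) = 0`, `λ(X(W/ℚ_∞)) = rank W₂(ℚ)` and `char_Λ X(W/ℚ_∞) = ((T+2)^{rank W₂(ℚ)})`** — the whole
Iwasawa module of `W` along `ℚ_∞` is the `(T+2)`-primary block carried by the rational points of `W⁽²⁾`. UNCONDITIONAL (no named fact).
[cite: GreenbergLNM1716, Thm. 1.9 (p. 63), Thm. 4.1 (p. 102), §4 p. 107] [cite: Washington1997, §7.1, §13.2] -/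
theorem mu_eq_zero_of_le_mordellWeilRank_twist (hord : IsOrdinaryAt W 2) (D : W.SelmerDualData κ γ)
    (hfin : Finite (W.selmerGroupPInfty 2)) {t e s : ℕ}
    (ht : Nat.card (AddCommGroup.primaryComponent W.toAffine.Point 2) = 2 ^ t)
    (he : Nat.card (AddCommGroup.primaryComponent ((integralModelInt W).map (Int.castRingHom (ZMod 2))).toAffine.Point 2) = 2 ^ e)
    (hs : Nat.card (W.selmerGroupPInfty 2) = 2 ^ s)
    (hsat : padicValNat 2 W.tamagawaProduct + 2 * e + s ≤ W₂.mordellWeilRank + 2 * t) :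
    D.mu = 0 ∧ D.lambda = W₂.mordellWeilRank ∧
      D.charIdeal = Ideal.span {(X + C (2 : ℤ_[2])) ^ W₂.mordellWeilRank} := by
  haveI : Module.Finite (IwasawaAlgebra 2) D.X := D.module_finite_holds hγ
  haveI : (charIdeal (IwasawaAlgebra 2) D.X).IsPrincipal := charIdeal_isPrincipal_holds 2 D.X
  obtain ⟨fX, hfX⟩ := Submodule.IsPrincipal.principal (charIdeal (IwasawaAlgebra 2) D.X)
  have hchar : D.charIdeal = Ideal.span {fX} := hfX
  have hD : D.IsTorsion := isTorsion_of_finite κ hκ hγ W hord D hfin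
  obtain ⟨hineq, hnorm⟩ := norm_constantCoeff_charGen_eq_of_thm41 W thm41_charValue_rankZero_anyPrime_holds
    ((isOrdinaryAt_iff W 2).mp hord).1 ((isOrdinaryAt_iff W 2).mp hord).2 hκ hγ hγ' D hD hchar hfin ht he hs
  have hdvd := X_add_C_two_pow_mordellWeilRank_twist_dvd_charGen κ hκ hγ W W₂ hV D hD hchar
  have hle := mu_add_le_of_X_add_C_two_pow_dvd hdvd hnorm
  -- the weight is exactly the rank of the twist
  have hw : padicValNat 2 W.tamagawaProduct + 2 * e + s - 2 * t = W₂.mordellWeilRank := by omega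
  rw [hw] at hnorm
  have hfX0 : constantCoeff fX ≠ 0 := by
    intro h0
    rw [h0, norm_zero] at hnorm
    exact (pow_ne_zero _ (by norm_num : ((2 : ℝ)⁻¹) ≠ 0)) hnorm.symm
  have hfXne : fX ≠ 0 := fun h0 => hfX0 (by rw [h0, map_zero])
  have hmufX : mu fX = D.mu := mu_generator_eq_muInvariant D.X hD hfXne hchar
  have hlamfX : lam fX = D.lambda := lam_generator_eq_lambdaInvariant D.X hD hfXne hchar
  obtain ⟨hmu0, hlam0⟩ := mu_eq_zero_and_lam_eq_of_X_add_C_two_pow_dvd hdvd hnorm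
  refine ⟨by rw [← hmufX, hmu0], by rw [← hlamfX, hlam0], ?_⟩
  rw [hchar]
  exact Ideal.span_singleton_eq_span_singleton.mpr (associated_X_add_C_two_pow_of_dvd hdvd hnorm).symm

end Datum

/-! ## §3 Datum-free statements -/

section DatumFree

variable (W W₂ : WeierstrassCurve ℚ) [W.IsElliptic] [W.IsGloballyMinimal] [W₂.IsElliptic] {V : VariableChange ℚ}
  (hV : V • W₂ = W.quadraticTwist 2)

include hV in
/-- ★★ **A MORDELL–WEIL BOUND FOR THE `√2`-TWIST FROM THE ARITHMETIC OF `W` OVER `ℚ` ALONE: `rank W⁽²⁾(ℚ) + 2t ≤ v + 2e + s`.** `W/ℚ` globally minimal,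
good ordinary at `2`, `Sel_{2^∞}(W/ℚ)` finite, `W₂` any `ℚ`-model of `W⁽²⁾`, exponents `t, e, s` as in §2, `v = ord₂ ∏c_ℓ`. UNCONDITIONAL: no Kato, no
`L`-function, no modular symbol (the lineage's `…TwistReadingBounds` had the unit-symbol case modulo Kato 17.4). E.g. `E(ℚ)[2] = 0`, `a₂ = +1`, `Ш(W/ℚ)[2] = 0`,
`∏c_ℓ` odd ⟹ `rank W⁽²⁾(ℚ) ≤ 2`. [cite: GreenbergLNM1716, Thm. 1.4 (p. 60), Thm. 1.9 (p. 63), Thm. 4.1 (p. 102), §4 p. 107] -/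
theorem mordellWeilRank_twist_le (hord : IsOrdinaryAt W 2) (hfin : Finite (W.selmerGroupPInfty 2)) {t e s : ℕ}
    (ht : Nat.card (AddCommGroup.primaryComponent W.toAffine.Point 2) = 2 ^ t)
    (he : Nat.card (AddCommGroup.primaryComponent ((integralModelInt W).map (Int.castRingHom (ZMod 2))).toAffine.Point 2) = 2 ^ e)
    (hs : Nat.card (W.selmerGroupPInfty 2) = 2 ^ s) :
    W₂.mordellWeilRank + 2 * t ≤ padicValNat 2 W.tamagawaProduct + 2 * e + s ∧
      W₂.selmerCorank 2 + 2 * t ≤ padicValNat 2 W.tamagawaProduct + 2 * e + s := by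
  obtain ⟨κ, hκ, γ, hγ, hγ'⟩ := exists_isCyclotomic_isTopGenerator_isCyclotomicVariable_holds 2
  obtain ⟨D⟩ := W.nonempty_selmerDualData_holds κ γ hγ
  have h1 := mordellWeilRank_twist_add_mu_add_le κ hκ hγ hγ' W W₂ hV hord D hfin ht he hs
  have h2 := selmerCorank_twist_add_mu_add_le κ hκ hγ hγ' W W₂ hV hord D hfin ht he hs
  constructor <;> omega

include hV in
/-- ★★★ **THE TWIST-SATURATION DOOR**: `W/ℚ` globally minimal, good ordinary at `2`, `Sel_{2^∞}(W/ℚ)` finite, `W₂` any `ℚ`-model of `W⁽²⁾`, `t, e, s, v`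
as in §2; if **`v + 2e + s ≤ rank W₂(ℚ) + 2t`** then **`μ(X(W/ℚ_∞)) = 0`** (and `λ = rank W₂(ℚ)`, `char X = ((T+2)^{rank W₂(ℚ)})`) at EVERY normalised
cyclotomic dual datum — the shape consumed by the Seed door `mazurMainConjecture_two_of_bsdp_of_mu_eq_zero` and by the crux's stub T. UNCONDITIONAL;
certificate = rational points on the twist + the numbers `t, e, s, v`. [cite: GreenbergLNM1716, Thm. 1.9 (p. 63), Thm. 4.1 (p. 102), §4 p. 107] -/
theorem forall_mu_eq_zero_of_le_mordellWeilRank_twist (hord : IsOrdinaryAt W 2) (hfin : Finite (W.selmerGroupPInfty 2))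
    {t e s : ℕ} (ht : Nat.card (AddCommGroup.primaryComponent W.toAffine.Point 2) = 2 ^ t)
    (he : Nat.card (AddCommGroup.primaryComponent ((integralModelInt W).map (Int.castRingHom (ZMod 2))).toAffine.Point 2) = 2 ^ e)
    (hs : Nat.card (W.selmerGroupPInfty 2) = 2 ^ s)
    (hsat : padicValNat 2 W.tamagawaProduct + 2 * e + s ≤ W₂.mordellWeilRank + 2 * t) :
    ∀ (κ : ZpExtension ℚ 2) (γ : Field.absoluteGaloisGroup ℚ), κ.IsCyclotomic → κ.IsTopGenerator γ →
      IsCyclotomicVariable 2 γ → ∀ D : W.SelmerDualData κ γ,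
        D.mu = 0 ∧ D.lambda = W₂.mordellWeilRank ∧ D.charIdeal = Ideal.span {(X + C (2 : ℤ_[2])) ^ W₂.mordellWeilRank} :=
  fun κ _ hκ hγ hγ' D => mu_eq_zero_of_le_mordellWeilRank_twist κ hκ hγ hγ' W W₂ hV hord D hfin ht he hs hsat

end DatumFree

/-! ## §4 On the seed cell, modulo PRINT: saturation ⟹ Mazur's main conjecture at `2` -/

section Seed

variable (W W₂ : WeierstrassCurve ℚ) [W.IsElliptic] [W.IsGloballyMinimal] [W₂.IsElliptic] {V : VariableChange ℚ}
  (hV : V • W₂ = W.quadraticTwist 2)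

omit [W₂.IsElliptic] [W.IsGloballyMinimal] in
/-- `Sel_{2^∞}(W/ℚ)` is finite in analytic rank `0`, granted Gross–Zagier–Kolyvagin (`hGZK`: rank `= r_an` and `Ш` finite for `r_an ≤ 1`):
`W(ℚ)` is finite in rank `0` and `Ш(W/ℚ)[2^∞] ≤ Ш(W/ℚ)` is finite (tree `finite_selmerGroupPInfty_iff`, Greenberg §1).
[cite: GreenbergLNM1716, §1 pp. 54–57] -/
theorem finite_selmerGroupPInfty_two_of_analyticRank_eq_zero (hGZK : rank_eq_analyticRank_of_analyticRank_le_one)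
    (hr : W.analyticRank = 0) : Finite (W.selmerGroupPInfty 2) := by
  -- adapted from Theorems/ByReductionTypeAtTwoSupersingularLineEulerChar.lean §1 (any `p`)
  obtain ⟨hrank, hfin⟩ := hGZK W (by omega)
  have hmw0 : W.mordellWeilRank = 0 := by rw [hrank, hr]
  haveI hE : Finite W.toAffine.Point := W.finite_point_of_rank_zero hmw0
  haveI := hfin
  haveI hS : Finite (AddCommGroup.primaryComponent W.sha 2) :=
    Finite.of_injective (fun x : AddCommGroup.primaryComponent W.sha 2 ↦ (x : W.sha)) Subtype.val_injective
  exact (W.finite_selmerGroupPInfty_iff 2).mpr ⟨hE, hS⟩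

include hV in
/-- ★★★ **THE TWIST-SATURATION DOOR ON THE SEED CELL, modulo PRINT.** `W` globally minimal, good ordinary at `2`, no rational point of order `2`,
`r_an(W) = 0`, `BSD(W,2)` (C2's own binders); PRINT `h17` (Kato 17.4 (1)(2) at `2`), `hper` (period unit), `hmod` (modularity), `hGZK` — Greenberg's
Thm. 4.1 is the tree theorem `thm41_charValue_rankZero_anyPrime_holds`, not a binder. DATA: `#W(ℚ)[2^∞] = 2^t`, `#Ẽ(𝔽₂)[2^∞] = 2^e`,
`#Sel_{2^∞}(W/ℚ) = 2^s` and the CERTIFICATE **`ord₂ ∏c_ℓ + 2e + s ≤ rank W₂(ℚ) + 2t`** for some `ℚ`-model `W₂` of `W⁽²⁾`. Then **Mazur's `2`-adic main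
conjecture holds for `W`**: §3 gives `μ(X(W/ℚ_∞)) = 0` at every normalised cyclotomic dual datum and the Seed door
`mazurMainConjecture_two_of_bsdp_of_mu_eq_zero` closes. C2's analytic-`μ` binder is idle on this door.
[cite: Kato2004Asterisque, Thm. 17.4 (1)(2) (p. 273)] [cite: GreenbergLNM1716, Thm. 4.1 (p. 102), §4 p. 107] [cite: AbbesUllmo1996, Thm. A] -/
theorem mazurMainConjecture_two_of_bsdp_of_le_mordellWeilRank_twist
    (h17 : ∀ [NeZero (W.conductorNorm ℤ)] (f : CuspForm (Gamma0 (W.conductorNorm ℤ)) 2),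
      kato_divisibility_allPrimes W 2 (f := f))
    (hper : realPeriodRat_eq_unit_mul_plusPeriod_two) (hmod : nonempty_modularParametrizationData)
    (hGZK : rank_eq_analyticRank_of_analyticRank_le_one) (hord : IsOrdinaryAt W 2)
    (ht2 : ∀ x : ℚ, ¬ HasRationalTwoTorsionX W x) (hr : W.analyticRank = 0) (hbsd : BSDp W 2) {t e s : ℕ}
    (ht : Nat.card (AddCommGroup.primaryComponent W.toAffine.Point 2) = 2 ^ t)
    (he : Nat.card (AddCommGroup.primaryComponent ((integralModelInt W).map (Int.castRingHom (ZMod 2))).toAffine.Point 2) = 2 ^ e)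
    (hs : Nat.card (W.selmerGroupPInfty 2) = 2 ^ s)
    (hsat : padicValNat 2 W.tamagawaProduct + 2 * e + s ≤ W₂.mordellWeilRank + 2 * t) :
    MazurMainConjecture W 2 := by
  have hfin : Finite (W.selmerGroupPInfty 2) := finite_selmerGroupPInfty_two_of_analyticRank_eq_zero W hGZK hr
  exact mazurMainConjecture_two_of_bsdp_of_mu_eq_zero W h17 thm41_charValue_rankZero_anyPrime_holds hper hmod hGZK hord ht2 hr hbsd
    fun κ γ hκ hγ hγ' D _ => (forall_mu_eq_zero_of_le_mordellWeilRank_twist W W₂ hV hord hfin ht he hs hsat κ γ hκ hγ hγ' D).1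

include hV in
/-- ★★ **UNIT-SYMBOL FORM, `a₂ = +1`: TWO INDEPENDENT RATIONAL POINTS ON `W⁽²⁾` GIVE MC₂(W).** `W` globally minimal, good ordinary at `2` with
`a₂(W) = +1`, no rational point of order `2`, `r_an(W) = 0`, `BSD(W,2)`, `f` its newform at level `N_W` with unit central symbol `‖[0]⁺_f‖₂ = 1`
(so `‖L₂(W,0)‖₂ = ¼`); PRINT `h17`, `hper`, `hmod`, `hGZK`. If **`2 ≤ rank W₂(ℚ)`** for a `ℚ`-model `W₂` of `W⁽²⁾`, then **Mazur's `2`-adic main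
conjecture holds for `W`** — the unit equation `‖f_X(0)‖₂ = ‖L₂(W,0)‖₂ = 2^{−2}` (lineage `norm_constantCoeff_charGen_eq_of_bsdp`) and
`(T+2)^{rank W₂} ∣ f_X` leave no room for `μ`. [cite: Kato2004Asterisque, Thm. 17.4 (1)(2) (p. 273)] [cite: MazurTateTeitelbaum1986Invent, §I.14]
[cite: GreenbergLNM1716, Thm. 4.1 (p. 102), §4 p. 107] -/
theorem mazurMainConjecture_two_of_bsdp_of_two_le_mordellWeilRank_twist [NeZero (W.conductorNorm ℤ)]
    {f : CuspForm (Gamma0 (W.conductorNorm ℤ)) 2}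
    (h17 : ∀ (f : CuspForm (Gamma0 (W.conductorNorm ℤ)) 2), kato_divisibility_allPrimes W 2 (f := f))
    (hper : realPeriodRat_eq_unit_mul_plusPeriod_two) (hmod : nonempty_modularParametrizationData)
    (hGZK : rank_eq_analyticRank_of_analyticRank_le_one) (hord : IsOrdinaryAt W 2)
    (ht2 : ∀ x : ℚ, ¬ HasRationalTwoTorsionX W x) (hr : W.analyticRank = 0) (hbsd : BSDp W 2) (hf : IsNewformOf W f)
    (ha : W.frobeniusTrace 2 = 1) {G : IwasawaAlgebra 2} (hG : iwasawaToPowerSeries 2 G = padicLFunction f (unitRoot W 2 : ℚ_[2]))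
    (hsym : ‖(ratPlusSymbol f 0 : ℚ_[2])‖ = 1) (hsat : 2 ≤ W₂.mordellWeilRank) :
    MazurMainConjecture W 2 := by
  have hfin : Finite (W.selmerGroupPInfty 2) := finite_selmerGroupPInfty_two_of_analyticRank_eq_zero W hGZK hr
  refine mazurMainConjecture_two_of_bsdp_of_mu_eq_zero W (fun f => h17 f) thm41_charValue_rankZero_anyPrime_holds hper hmod hGZK
    hord ht2 hr hbsd ?_
  intro κ γ hκ hγ hγ' D _
  haveI : Module.Finite (IwasawaAlgebra 2) D.X := D.module_finite_holds hγ
  haveI : (charIdeal (IwasawaAlgebra 2) D.X).IsPrincipal := charIdeal_isPrincipal_holds 2 D.X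
  obtain ⟨fX, hfX⟩ := Submodule.IsPrincipal.principal (charIdeal (IwasawaAlgebra 2) D.X)
  have hchar : D.charIdeal = Ideal.span {fX} := hfX
  have hD : D.IsTorsion := isTorsion_of_finite κ hκ hγ W hord D hfin
  obtain ⟨hfX0, -, heq⟩ := norm_constantCoeff_charGen_eq_of_bsdp W thm41_charValue_rankZero_anyPrime_holds hper hGZK hord ht2 hr hbsd
    hf hG hκ hγ hγ' D hD hchar
  rw [norm_constantCoeff_lift_eq_quarter_of_frobeniusTrace_eq_one W hord hf ha hG hsym,
    show (4 : ℝ)⁻¹ = (2 : ℝ)⁻¹ ^ 2 by norm_num] at heq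
  have hdvd := X_add_C_two_pow_mordellWeilRank_twist_dvd_charGen κ hκ hγ W W₂ hV D hD hchar
  have hle := mu_add_le_of_X_add_C_two_pow_dvd hdvd heq
  have hfXne : fX ≠ 0 := fun h0 => hfX0 (by rw [h0, map_zero])
  have hmufX : mu fX = D.mu := mu_generator_eq_muInvariant D.X hD hfXne hchar
  rw [← hmufX]
  omega

include hV in
/-- ★ **UNIT-SYMBOL FORM, `a₂ = −1`: FOUR INDEPENDENT RATIONAL POINTS ON `W⁽²⁾` GIVE MC₂(W)** (`‖L₂(W,0)‖₂ = 2^{−4}`; otherwise as in the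
`a₂ = +1` form). [cite: Kato2004Asterisque, Thm. 17.4 (1)(2) (p. 273)] [cite: MazurTateTeitelbaum1986Invent, §I.14] [cite: GreenbergLNM1716, Thm. 4.1 (p. 102)] -/
theorem mazurMainConjecture_two_of_bsdp_of_four_le_mordellWeilRank_twist [NeZero (W.conductorNorm ℤ)]
    {f : CuspForm (Gamma0 (W.conductorNorm ℤ)) 2}
    (h17 : ∀ (f : CuspForm (Gamma0 (W.conductorNorm ℤ)) 2), kato_divisibility_allPrimes W 2 (f := f))
    (hper : realPeriodRat_eq_unit_mul_plusPeriod_two) (hmod : nonempty_modularParametrizationData)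
    (hGZK : rank_eq_analyticRank_of_analyticRank_le_one) (hord : IsOrdinaryAt W 2)
    (ht2 : ∀ x : ℚ, ¬ HasRationalTwoTorsionX W x) (hr : W.analyticRank = 0) (hbsd : BSDp W 2) (hf : IsNewformOf W f)
    (ha : W.frobeniusTrace 2 = -1) {G : IwasawaAlgebra 2} (hG : iwasawaToPowerSeries 2 G = padicLFunction f (unitRoot W 2 : ℚ_[2]))
    (hsym : ‖(ratPlusSymbol f 0 : ℚ_[2])‖ = 1) (hsat : 4 ≤ W₂.mordellWeilRank) :
    MazurMainConjecture W 2 := by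
  have hfin : Finite (W.selmerGroupPInfty 2) := finite_selmerGroupPInfty_two_of_analyticRank_eq_zero W hGZK hr
  refine mazurMainConjecture_two_of_bsdp_of_mu_eq_zero W (fun f => h17 f) thm41_charValue_rankZero_anyPrime_holds hper hmod hGZK
    hord ht2 hr hbsd ?_
  intro κ γ hκ hγ hγ' D _
  haveI : Module.Finite (IwasawaAlgebra 2) D.X := D.module_finite_holds hγ
  haveI : (charIdeal (IwasawaAlgebra 2) D.X).IsPrincipal := charIdeal_isPrincipal_holds 2 D.X
  obtain ⟨fX, hfX⟩ := Submodule.IsPrincipal.principal (charIdeal (IwasawaAlgebra 2) D.X)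
  have hchar : D.charIdeal = Ideal.span {fX} := hfX
  have hD : D.IsTorsion := isTorsion_of_finite κ hκ hγ W hord D hfin
  obtain ⟨hfX0, -, heq⟩ := norm_constantCoeff_charGen_eq_of_bsdp W thm41_charValue_rankZero_anyPrime_holds hper hGZK hord ht2 hr hbsd
    hf hG hκ hγ hγ' D hD hchar
  rw [norm_constantCoeff_lift_of_frobeniusTrace_eq_neg_one W hord hf ha hG hsym] at heq
  have hdvd := X_add_C_two_pow_mordellWeilRank_twist_dvd_charGen κ hκ hγ W W₂ hV D hD hchar
  have hle := mu_add_le_of_X_add_C_two_pow_dvd hdvd heq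
  have hfXne : fX ≠ 0 := fun h0 => hfX0 (by rw [h0, map_zero])
  have hmufX : mu fX = D.mu := mu_generator_eq_muInvariant D.X hD hfXne hchar
  rw [← hmufX]
  omega

end Seed

end Summit.BirchSwinnertonDyer.BirchSwinnertonDyer.Theorems.AlignedTransportAtTwoTwistSaturation

end
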